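import Summits.Ventures.HodgeRepro2.T5BergmanSchurGeneral
import Summits.Ventures.HodgeRepro2.T5BergmanSchurU11

/-!
# The general Schur relation on `H_j = U(1,1)`

On `U(1,1) = Z · SU(1,1)` the weight-`k` model `actU` (`T5BergmanU11`) has central character `λ ↦ λ^k`,
so the general matrix coefficient `matrixCoeffU k f h g = ⟨π_k(g) f, h⟩_k` satisfies
`⟨π_k(λ g) f, h⟩_k = λ^k ⟨π_k(g) f, h⟩_k` (`matrixCoeffU_mulHom`) and `|⟨π_k(λ g) f, h⟩|²` is invariant
under the centre. The product map `mulHom : Circle × SU(1,1) → U(1,1)` is a quotient map (the open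
mapping theorem for σ-compact groups, `isQuotientMap_mulHom`), which gives the continuity of
`|matrixCoeffU|²` on `U(1,1)` from its continuity on `SU(1,1)`; through the product formula for the Haar
measure of `U(1,1)` (`T5U11Product.integral_eq_of_scalar_invariant`) the general Schur relation of
`T5BergmanSchurGeneral` becomes, for every Haar measure `μ_U` of `U(1,1)` and ALL holomorphic
`f, h ∈ A_k`:

  `c_U • ∫_{U(1,1)} |⟨π_k(g) f, h⟩_k|² dμ_U = π ⟨f,f⟩_k ⟨h,h⟩_k / (k-1)`   (`integral_norm_matrixCoeffU_sq`),

`c_U = haarScalarFactor (map mulHom (haarCircle ⊗ ν)) μ_U > 0` — the pair `(1, h)` being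
`T5BergmanSchurU11.integral_norm_coeffLowestU_sq`; the integral is POSITIVE for `f, h ≠ 0`
(`integral_norm_matrixCoeffU_sq_pos`).

Blind lane: Mathlib + the HodgeRepro2 prefix only; no sorry; axioms ⊆ {propext, Classical.choice,
Quot.sound}.
-/

namespace Summit.Ventures.HodgeRepro2.T5BergmanSchurGeneralU11

open MeasureTheory MeasureTheory.Measure Metric Filter Topology
open T5PoincareMeasure T5SU11Unimodular T5U11Unimodular T5U11Product T5SU11Fibration
  T5SU11FibrationHaar T5SU11FibrationCartan T5HaarCircle T5SU11CoefficientL2 T5U11CoefficientL2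
open T5BergmanCoefficient T5BergmanPairing T5BergmanUnitary T5BergmanCoefficientL2 T5BergmanU11
  T5BergmanParseval T5BergmanFourier T5BergmanKernel T5BergmanSchur T5BergmanActStable
  T5BergmanMatrixCoeff T5BergmanSchurGeneral T5BergmanSchurU11
open scoped Real

/-- The matrix coefficient `g ↦ ⟨π_k(g) f, h⟩_k` on `U(1,1)`. -/
noncomputable def matrixCoeffU (k : ℕ) (f h : ℂ → ℂ) (g : U11) : ℂ := pairing k (actU k g f) h

/-- `⟨π_k(λ g) f, h⟩_k = λ^k ⟨π_k(g) f, h⟩_k` for `g ∈ SU(1,1)` embedded in `U(1,1)`. -/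
theorem matrixCoeffU_mulHom (k : ℕ) (f h : ℂ → ℂ) (lam : Circle) (g : SU11) :
    matrixCoeffU k f h (mulHom (lam, g)) = (lam : ℂ) ^ k * matrixCoeff k f h g := by
  unfold matrixCoeffU matrixCoeff
  have e : ∀ z ∈ ball (0 : ℂ) 1, actU k (mulHom (lam, g)) f z = (lam : ℂ) ^ k * act k g f z :=
    fun z _ => actU_mulHom k lam g f z
  rw [pairing_congr e (fun _ _ => rfl), pairing_const_mul_left]

/-- The square of the coefficient is invariant under the centre. -/
theorem norm_matrixCoeffU_mulHom (k : ℕ) (f h : ℂ → ℂ) (lam : Circle) (g : SU11) :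
    ‖matrixCoeffU k f h (mulHom (lam, g))‖ ^ 2 = ‖matrixCoeff k f h g‖ ^ 2 := by
  rw [matrixCoeffU_mulHom, norm_mul, norm_pow, Circle.norm_coe, one_pow, one_mul]

/-- `|matrixCoeffU|²` is invariant under left multiplication by the centre. -/
theorem norm_matrixCoeffU_sq_scalarHom_mul (k : ℕ) (f h : ℂ → ℂ) (lam : Circle) (g : U11) :
    ‖matrixCoeffU k f h (scalarHom lam * g)‖ ^ 2 = ‖matrixCoeffU k f h g‖ ^ 2 := by
  obtain ⟨⟨mu, g'⟩, rfl⟩ := mulHom_surjective g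
  have e : scalarHom lam * mulHom (mu, g') = mulHom (lam * mu, g') := by
    rw [mulHom_apply, mulHom_apply, map_mul, mul_assoc]
  rw [e, norm_matrixCoeffU_mulHom, norm_matrixCoeffU_mulHom]

/-- On the embedded `SU(1,1)` the coefficient is the `SU(1,1)` one. -/
theorem matrixCoeffU_incl (k : ℕ) (f h : ℂ → ℂ) (g : SU11) :
    matrixCoeffU k f h (incl g) = matrixCoeff k f h g := by
  have : incl g = mulHom (1, g) := by rw [mulHom_apply, map_one, one_mul]
  rw [this, matrixCoeffU_mulHom, Circle.coe_one, one_pow, one_mul]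

/-- **The product map `Circle × SU(1,1) → U(1,1)` is a quotient map** (a continuous surjective
homomorphism from a σ-compact group onto a locally compact group is open). -/
theorem isQuotientMap_mulHom : IsQuotientMap mulHom :=
  (MonoidHom.isOpenMap_of_sigmaCompact mulHom mulHom_surjective continuous_mulHom).isQuotientMap
    continuous_mulHom mulHom_surjective

/-- `|matrixCoeffU|²` is continuous on `U(1,1)` for holomorphic `f, h ∈ A_k`. -/
theorem continuous_norm_matrixCoeffU_sq (k : ℕ) (hk : 2 ≤ k) (f h : ℂ → ℂ)
    (hf : DifferentiableOn ℂ f (ball 0 1))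
    (hfint : IntegrableOn (fun w => ‖f w‖ ^ 2 * (1 - ‖w‖ ^ 2) ^ (k - 2)) (ball (0 : ℂ) 1))
    (hh : DifferentiableOn ℂ h (ball 0 1))
    (hhint : IntegrableOn (fun w => ‖h w‖ ^ 2 * (1 - ‖w‖ ^ 2) ^ (k - 2)) (ball (0 : ℂ) 1)) :
    Continuous fun g : U11 => ‖matrixCoeffU k f h g‖ ^ 2 := by
  rw [isQuotientMap_mulHom.continuous_iff]
  have e : ((fun g : U11 => ‖matrixCoeffU k f h g‖ ^ 2) ∘ mulHom) =
      fun p : Circle × SU11 => ‖matrixCoeff k f h p.2‖ ^ 2 := by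
    ext p
    exact norm_matrixCoeffU_mulHom k f h p.1 p.2
  rw [e]
  exact ((continuous_matrixCoeff_of_differentiableOn k hk f hf hfint h hh hhint).comp
    continuous_snd).norm.pow 2

variable [MeasurableSpace Circle] [BorelSpace Circle]

/-- The general Schur relation against the fibration measure `ν = π μ_R` of `SU(1,1)`:
`∫_G |⟨π_k(g) f, h⟩_k|² dν = π ⟨f,f⟩_k ⟨h,h⟩_k / (k-1)`, with a `ν`-integrable integrand. -/
theorem integral_norm_matrixCoeff_sq_nu (k : ℕ) (hk : 2 ≤ k) (f h : ℂ → ℂ)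
    (hf : DifferentiableOn ℂ f (ball 0 1))
    (hfint : IntegrableOn (fun w => ‖f w‖ ^ 2 * (1 - ‖w‖ ^ 2) ^ (k - 2)) (ball (0 : ℂ) 1))
    (hh : DifferentiableOn ℂ h (ball 0 1))
    (hhint : IntegrableOn (fun w => ‖h w‖ ^ 2 * (1 - ‖w‖ ^ 2) ^ (k - 2)) (ball (0 : ℂ) 1)) :
    Integrable (fun g => ‖matrixCoeff k f h g‖ ^ 2) (nu haarCircle) ∧
      ∫ g, ‖matrixCoeff k f h g‖ ^ 2 ∂(nu haarCircle) =
        π * ((pairing k f f).re * (pairing k h h).re / ((k : ℝ) - 1)) := by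
  obtain ⟨hi, he⟩ := integral_norm_matrixCoeff_sq_ruhl k hk _ f hf (hasSum_taylor f hf) hfint _ h
    (hasSum_taylor h hh) hhint
  have hπ : (0 : ℝ) < π := Real.pi_pos
  have hc0 : ENNReal.ofReal π⁻¹ ≠ 0 := by
    rw [Ne, ENNReal.ofReal_eq_zero]
    exact not_le.mpr (inv_pos.mpr hπ)
  unfold ruhl at hi he
  rw [integrable_smul_measure hc0 ENNReal.ofReal_ne_top] at hi
  rw [integral_smul_measure, ENNReal.toReal_ofReal (by positivity), smul_eq_mul] at he
  refine ⟨hi, ?_⟩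
  rw [← he]
  field_simp

variable [MeasurableSpace U11] [BorelSpace U11]

/-- **Integrability against every Haar measure of `U(1,1)`**. -/
theorem integrable_norm_matrixCoeffU_sq (μU : Measure U11) [IsHaarMeasure μU] (k : ℕ) (hk : 2 ≤ k)
    (f h : ℂ → ℂ) (hf : DifferentiableOn ℂ f (ball 0 1))
    (hfint : IntegrableOn (fun w => ‖f w‖ ^ 2 * (1 - ‖w‖ ^ 2) ^ (k - 2)) (ball (0 : ℂ) 1))
    (hh : DifferentiableOn ℂ h (ball 0 1))
    (hhint : IntegrableOn (fun w => ‖h w‖ ^ 2 * (1 - ‖w‖ ^ 2) ^ (k - 2)) (ball (0 : ℂ) 1)) :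
    Integrable (fun g => ‖matrixCoeffU k f h g‖ ^ 2) μU := by
  set c := haarScalarFactor (map mulHom (haarCircle.prod (nu haarCircle))) μU with hc
  have hc0 : c ≠ 0 := (T5U11Product.haarScalarFactor_pos haarCircle (nu haarCircle) μU).ne'
  have hmap : map mulHom (haarCircle.prod (nu haarCircle)) = c • μU :=
    map_mulHom_prod_eq_smul haarCircle (nu haarCircle) μU
  have hmeas : AEStronglyMeasurable (fun g => ‖matrixCoeffU k f h g‖ ^ 2)
      (map mulHom (haarCircle.prod (nu haarCircle))) :=
    (continuous_norm_matrixCoeffU_sq k hk f h hf hfint hh hhint).aestronglyMeasurable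
  have hint' : Integrable (fun g => ‖matrixCoeffU k f h g‖ ^ 2)
      (map mulHom (haarCircle.prod (nu haarCircle))) := by
    rw [integrable_map_measure hmeas continuous_mulHom.measurable.aemeasurable]
    have e : ((fun g => ‖matrixCoeffU k f h g‖ ^ 2) ∘ mulHom) =
        fun q : Circle × SU11 => ‖matrixCoeff k f h q.2‖ ^ 2 := by
      ext q
      exact norm_matrixCoeffU_mulHom k f h q.1 q.2
    rw [e]
    exact (integral_norm_matrixCoeff_sq_nu k hk f h hf hfint hh hhint).1.comp_snd haarCircle
  rw [hmap] at hint'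
  exact (integrable_smul_measure (ENNReal.coe_ne_zero.mpr hc0) ENNReal.coe_ne_top).mp hint'

/-- **The general Schur relation on `H_j = U(1,1)`**:
`c_U • ∫_{U(1,1)} |⟨π_k(g) f, h⟩_k|² dμ_U = π ⟨f,f⟩_k ⟨h,h⟩_k / (k-1)` for every Haar measure `μ_U` of
`U(1,1)` and all holomorphic `f, h ∈ A_k`, `c_U = haarScalarFactor (map mulHom (haarCircle ⊗ ν)) μ_U`. -/
theorem integral_norm_matrixCoeffU_sq (μU : Measure U11) [IsHaarMeasure μU] (k : ℕ) (hk : 2 ≤ k)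
    (f h : ℂ → ℂ) (hf : DifferentiableOn ℂ f (ball 0 1))
    (hfint : IntegrableOn (fun w => ‖f w‖ ^ 2 * (1 - ‖w‖ ^ 2) ^ (k - 2)) (ball (0 : ℂ) 1))
    (hh : DifferentiableOn ℂ h (ball 0 1))
    (hhint : IntegrableOn (fun w => ‖h w‖ ^ 2 * (1 - ‖w‖ ^ 2) ^ (k - 2)) (ball (0 : ℂ) 1)) :
    (haarScalarFactor (map mulHom (haarCircle.prod (nu haarCircle))) μU : ℝ) •
      ∫ g, ‖matrixCoeffU k f h g‖ ^ 2 ∂μU =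
        π * ((pairing k f f).re * (pairing k h h).re / ((k : ℝ) - 1)) := by
  rw [integral_eq_of_scalar_invariant haarCircle (nu haarCircle) μU _
    (integrable_norm_matrixCoeffU_sq μU k hk f h hf hfint hh hhint)
    (norm_matrixCoeffU_sq_scalarHom_mul k f h), haarCircle_univ, ENNReal.toReal_one, one_smul]
  simp_rw [matrixCoeffU_incl]
  exact (integral_norm_matrixCoeff_sq_nu k hk f h hf hfint hh hhint).2

/-- The integral over `H_j` is positive for `f, h ≠ 0` in the space (every weight, every pair). -/
theorem integral_norm_matrixCoeffU_sq_pos (μU : Measure U11) [IsHaarMeasure μU] (k : ℕ) (hk : 2 ≤ k)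
    (f h : ℂ → ℂ) (hf : DifferentiableOn ℂ f (ball 0 1))
    (hfint : IntegrableOn (fun w => ‖f w‖ ^ 2 * (1 - ‖w‖ ^ 2) ^ (k - 2)) (ball (0 : ℂ) 1))
    (hh : DifferentiableOn ℂ h (ball 0 1))
    (hhint : IntegrableOn (fun w => ‖h w‖ ^ 2 * (1 - ‖w‖ ^ 2) ^ (k - 2)) (ball (0 : ℂ) 1))
    (hf0 : 0 < (pairing k f f).re) (hh0 : 0 < (pairing k h h).re) :
    0 < ∫ g, ‖matrixCoeffU k f h g‖ ^ 2 ∂μU := by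
  have hk1 : (0 : ℝ) < (k : ℝ) - 1 := by
    have : (2 : ℝ) ≤ k := by exact_mod_cast hk
    linarith
  have hI := integral_norm_matrixCoeffU_sq μU k hk f h hf hfint hh hhint
  have hc : (0 : ℝ) < haarScalarFactor (map mulHom (haarCircle.prod (nu haarCircle))) μU := by
    exact_mod_cast T5U11Product.haarScalarFactor_pos haarCircle (nu haarCircle) μU
  rw [smul_eq_mul] at hI
  have hpos : (0 : ℝ) < π * ((pairing k f f).re * (pairing k h h).re / ((k : ℝ) - 1)) := by
    have := Real.pi_pos
    positivity
  rw [← hI] at hpos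
  exact pos_of_mul_pos_right hpos hc.le

end Summit.Ventures.HodgeRepro2.T5BergmanSchurGeneralU11
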